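import Literature.AlgebraicGeometry.Resolution.SeparatingBlowup
import HarnessLib

/-!
# Separating finitely many disjoint opens by one admissible blowing up (Stacks 080P, iterated)

Topic: `Literature/AlgebraicGeometry/Resolution`. The finite form of Stacks, Tag 080P (Divisors,
Lemma 31.35.5; in the proof of Tag 0811 it is applied "`c - 1` more times"): for pairwise
disjoint quasi-compact opens `U₁, …, U_n` of a quasi-compact quasi-separated scheme `X` there is
ONE `⋃ Uᵢ`-admissible blowing up `b : X' → X` and a decomposition of `X'` into pairwise disjoint
opens `T₁ ⊔ … ⊔ T_n = X'` with `b⁻¹(Uᵢ) ⊆ Tᵢ`. Proof as for two opens (`SeparatingBlowup.lean`):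
finite type ideals `𝓘ᵢ` with `V(𝓘ᵢ) = X ∖ Uᵢ`, made pairwise orthogonal (`𝓘ᵢ 𝓘ⱼ = 0`, `i ≠ j`)
by passing to powers, and `b` the blowing up in `∑ 𝓘ᵢ`; on a chart where the exceptional ideal
is `(t)`, at each prime exactly one `𝓘ᵢ𝒪_{X'}` is `(t)` and the others die nearby
(`Ideal.exists_eq_span_of_biSup_eq_span`), so `Tᵢ = ⋂_{j ≠ i} {𝓘ⱼ𝒪_{X'} = 0}` works.

* `Ideal.exists_eq_span_of_biSup_eq_span` — in a local ring, `∑ᵢ Iᵢ = (t)`, `t` a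
  non-zero-divisor ⇒ some `Iᵢ = (t)`;
* `exists_pow_forall_mul_eq_bot` — a common exponent making the `𝓘ᵢ` pairwise orthogonal;
* `exists_isBlowup_separating_finite` — **the finite separation theorem.**

## References

* The Stacks Project, Tag 080P, Tag 0811 (proof). [StacksProject]
-/

noncomputable section

open CategoryTheory CategoryTheory.Limits AlgebraicGeometry TopologicalSpace

namespace Literature.AlgebraicGeometry.Resolution

universe u

/-! ## Local algebra -/

section Algebra

variable {R : Type u} [CommRing R]

/-- In a local ring, if a finite sum of ideals is `(t)` with `t` a non-zero-divisor then one of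
the ideals is `(t)` (induction from the case of two ideals,
`Ideal.eq_span_or_eq_span_of_sup_eq_span`). [cite: StacksProject, Tag 080P (proof)] -/
theorem Ideal.exists_eq_span_of_biSup_eq_span [IsLocalRing R] {ι : Type*} (I : ι → Ideal R) {t : R}
    (ht : t ∈ nonZeroDivisors R) (s : Finset ι) (h : ⨆ i ∈ s, I i = Ideal.span {t}) :
    ∃ i ∈ s, I i = Ideal.span {t} := by
  classical
  induction s using Finset.induction_on with
  | empty =>
    exfalso
    rw [show (⨆ i ∈ (∅ : Finset ι), I i) = ⊥ by simp, eq_comm, Ideal.span_singleton_eq_bot] at h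
    rw [h] at ht
    exact one_ne_zero ((mul_right_mem_nonZeroDivisors_eq_zero_iff ht).mp (mul_zero (1 : R)))
  | insert a s ha ih =>
    rw [Finset.iSup_insert] at h
    rcases Ideal.eq_span_or_eq_span_of_sup_eq_span ht h with h1 | h2
    · exact ⟨a, Finset.mem_insert_self a s, h1⟩
    · obtain ⟨i, hi, h3⟩ := ih h2
      exact ⟨i, Finset.mem_insert_of_mem hi, h3⟩

/-- The local polychotomy: if `∑ᵢ Iᵢ = (t)` with `t` a non-zero-divisor, the `Iᵢ` finitely
generated and pairwise orthogonal (`Iᵢ Iⱼ = 0` for `i ≠ j`), then every prime has a basic open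
neighbourhood on which all but one `Iᵢ` die. [cite: StacksProject, Tag 080P (proof)] -/
theorem Ideal.exists_away_forall_ne_map_eq_bot {ι : Type*} [Fintype ι] [DecidableEq ι]
    (I : ι → Ideal R) (hfg : ∀ i, (I i).FG) {t : R} (ht : t ∈ nonZeroDivisors R)
    (hsup : ⨆ i, I i = Ideal.span {t}) (hmul : ∀ i j, i ≠ j → I i * I j = ⊥) (p : Ideal R)
    [p.IsPrime] :
    ∃ (i : ι) (g : R), g ∉ p ∧ ∀ (Rg : Type u) [CommRing Rg] [Algebra R Rg] [IsLocalization.Away g Rg],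
      ∀ j, j ≠ i → (I j).map (algebraMap R Rg) = ⊥ := by
  have htp : algebraMap R (Localization.AtPrime p) t ∈ nonZeroDivisors (Localization.AtPrime p) :=
    IsLocalization.mem_nonZeroDivisors_algebraMap p.primeCompl (Localization.AtPrime p) ht
  have hsup' : ⨆ i ∈ (Finset.univ : Finset ι), (I i).map (algebraMap R (Localization.AtPrime p)) =
      Ideal.span {algebraMap R (Localization.AtPrime p) t} := by
    have h : ⨆ i ∈ (Finset.univ : Finset ι), (I i).map (algebraMap R (Localization.AtPrime p)) =
        ⨆ i, (I i).map (algebraMap R (Localization.AtPrime p)) := by simp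
    rw [h, ← Ideal.map_iSup, hsup, Ideal.map_span, Set.image_singleton]
  obtain ⟨i, -, hi⟩ := Ideal.exists_eq_span_of_biSup_eq_span _ htp Finset.univ hsup'
  -- the other ideals die at `𝔭`, hence on basic opens `D(g_j)`; take `g = ∏ g_j`
  have hdie : ∀ j, j ≠ i → ∃ g : R, g ∉ p ∧ ∀ (Rg : Type u) [CommRing Rg] [Algebra R Rg]
      [IsLocalization.Away g Rg], (I j).map (algebraMap R Rg) = ⊥ := fun j hj =>
    Ideal.exists_map_away_eq_bot_of_map_atPrime (hfg j) p
      (Ideal.eq_bot_of_mul_eq_bot_of_eq_span htp (by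
        rw [← Ideal.map_mul, hmul i j (Ne.symm hj), Ideal.map_bot]) hi)
  choose! g hg using hdie
  refine ⟨i, ∏ j ∈ Finset.univ.erase i, g j, fun hmem => ?_, fun Rg _ _ _ j hj => ?_⟩
  · obtain ⟨j, hj, hjp⟩ := Ideal.IsPrime.prod_mem_iff.mp hmem
    exact (hg j (Finset.ne_of_mem_erase hj)).1 hjp
  · -- each `x ∈ I_j` is killed by a power of `g_j`, hence by a power of `∏ g`
    have hjm : j ∈ Finset.univ.erase i := Finset.mem_erase.mpr ⟨hj, Finset.mem_univ j⟩
    obtain ⟨c, hc⟩ : g j ∣ ∏ k ∈ Finset.univ.erase i, g k := Finset.dvd_prod_of_mem g hjm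
    rw [Ideal.map_eq_bot_iff_le_ker]
    intro x hx
    have h0 : algebraMap R (Localization.Away (g j)) x = 0 := by
      have h := (hg j hj).2 (Localization.Away (g j))
      rw [Ideal.map_eq_bot_iff_le_ker] at h
      exact h hx
    obtain ⟨⟨_, m, rfl⟩, hm⟩ := (IsLocalization.map_eq_zero_iff (Submonoid.powers (g j)) _ x).mp h0
    rw [RingHom.mem_ker, IsLocalization.map_eq_zero_iff
      (Submonoid.powers (∏ k ∈ Finset.univ.erase i, g k)) Rg]
    refine ⟨⟨_, m, rfl⟩, ?_⟩
    show (∏ k ∈ Finset.univ.erase i, g k) ^ m * x = 0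
    change g j ^ m * x = 0 at hm
    rw [hc, mul_pow, mul_comm (g j ^ m), mul_assoc, hm, mul_zero]

end Algebra

/-! ## Making finitely many ideal sheaves pairwise orthogonal -/

section Powers

variable {X : Scheme.{u}} [CompactSpace X] {ι : Type*} [Fintype ι]

/-- A common exponent: for finite type ideal sheaves `𝓘ᵢ` on a quasi-compact scheme with
`V(𝓘ᵢ 𝓘ⱼ) = X` for `i ≠ j`, some `n` has `𝓘ᵢⁿ 𝓘ⱼⁿ = 0` for all `i ≠ j`.
[cite: StacksProject, Tag 080P (proof)] -/
theorem exists_pow_forall_mul_eq_bot (I : ι → X.IdealSheafData)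
    (hI : ∀ i (W : X.affineOpens), ((I i).ideal W).FG)
    (hsupp : ∀ i j, i ≠ j → (I i * I j).support = ⊤) :
    ∃ n : ℕ, ∀ i j, i ≠ j → I i ^ n * I j ^ n = ⊥ := by
  classical
  have h : ∀ q : ι × ι, ∃ n : ℕ, q.1 ≠ q.2 → I q.1 ^ n * I q.2 ^ n = ⊥ := fun q => by
    by_cases hq : q.1 = q.2
    · exact ⟨0, fun h => (h hq).elim⟩
    · obtain ⟨n, hn⟩ := exists_pow_mul_pow_eq_bot (I q.1) (I q.2) (hI q.1) (hI q.2) (hsupp _ _ hq)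
      exact ⟨n, fun _ => hn⟩
  choose n hn using h
  refine ⟨Finset.univ.sup n, fun i j hij => ?_⟩
  have hle : n (i, j) ≤ Finset.univ.sup n := Finset.le_sup (Finset.mem_univ (i, j))
  have h0 := hn (i, j) hij
  simp only at h0
  rw [← Nat.sub_add_cancel hle, pow_add, pow_add, mul_mul_mul_comm, h0,
    Scheme.IdealSheafData.mul_bot]

end Powers

/-! ## The finite separation theorem -/

section Statement

variable {X : Scheme.{u}}

/-- **Stacks 080P for finitely many opens**: let `X` be quasi-compact and quasi-separated and
`Uᵢ` (`i ∈ ι`, finite) pairwise disjoint quasi-compact opens. Then there is a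
`⋃ Uᵢ`-admissible blowing up `b : X' → X` — in a finite type ideal sheaf `𝓒` with
`V(𝓒) ∩ ⋃ Uᵢ = ∅` — and opens `Tᵢ ⊆ X'` with `⨆ Tᵢ = X'`, `Tᵢ ∩ Tⱼ = ∅` for `i ≠ j`, and
`b⁻¹(Uᵢ) ⊆ Tᵢ`. [cite: StacksProject, Tag 080P; Tag 0811 (proof)] -/
theorem exists_isBlowup_separating_finite [CompactSpace X] [QuasiSeparatedSpace X] {ι : Type}
    [Fintype ι] [DecidableEq ι] (U : ι → X.Opens) (hU : ∀ i, IsCompact (U i : Set X))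
    (hdisj : ∀ i j, i ≠ j → Disjoint (U i) (U j)) :
    ∃ (C : X.IdealSheafData) (X' : Scheme.{u}) (b : X' ⟶ X) (T : ι → X'.Opens),
      (∀ W : X.affineOpens, (C.ideal W).FG) ∧
      Disjoint ((⨆ i, U i : X.Opens) : Set X) (C.support : Set X) ∧ IsBlowup b C ∧
      (⨆ i, T i) = ⊤ ∧ (∀ i j, i ≠ j → T i ⊓ T j = ⊥) ∧ ∀ i, b ⁻¹ᵁ U i ≤ T i := by
  classical
  -- finite type ideals with `V(𝓘ᵢ) = X ∖ Uᵢ`, made pairwise orthogonal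
  have hex : ∀ i, ∃ I : X.IdealSheafData, (∀ W : X.affineOpens, (I.ideal W).FG) ∧
      (I.support : Set X) = (U i : Set X)ᶜ := fun i => exists_fg_support_eq_compl (U i) (hU i)
  choose I₀ hI₀fg hI₀supp using hex
  have hsupp : ∀ i j, i ≠ j → (I₀ i * I₀ j).support = ⊤ := fun i j hij => by
    apply SetLike.coe_injective
    rw [Scheme.IdealSheafData.support_mul, Closeds.coe_sup, hI₀supp, hI₀supp, Closeds.coe_top,
      ← Set.compl_inter, Set.compl_univ_iff, ← Opens.coe_inf, ← Opens.coe_bot]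
    exact congrArg SetLike.coe (disjoint_iff.mp (hdisj i j hij))
  obtain ⟨n, hn⟩ := exists_pow_forall_mul_eq_bot I₀ hI₀fg hsupp
  let I : ι → X.IdealSheafData := fun i => I₀ i ^ (n + 1)
  have hIfg : ∀ i (W : X.affineOpens), ((I i).ideal W).FG := fun i W => by
    simp only [I, Scheme.IdealSheafData.ideal_pow, Pi.pow_apply]
    exact (hI₀fg i W).pow
  have hIsupp : ∀ i, ((I i).support : Set X) = (U i : Set X)ᶜ := fun i => by
    simp only [I, Scheme.IdealSheafData.support_pow_succ, hI₀supp]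
  have hIU : ∀ i, centreCompl (I i) = U i := fun i => centreCompl_eq_of_support_eq (hIsupp i)
  have hImul : ∀ i j, i ≠ j → I i * I j = ⊥ := fun i j hij => by
    show I₀ i ^ (n + 1) * I₀ j ^ (n + 1) = ⊥
    rw [pow_succ, pow_succ, mul_mul_mul_comm, hn i j hij, Scheme.IdealSheafData.bot_mul]
  -- blow up `∑ 𝓘ᵢ`
  obtain ⟨X', b, hb⟩ := Stacks01OG_holds X (⨆ i, I i)
  let T : ι → X'.Opens := fun i => ⨅ j : {j // j ≠ i}, vanishingOpen ((I j).comap b)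
  -- the exceptional ideal `E = ∑ 𝓘ᵢ𝒪_{X'}` on affine opens of `X'`
  have hE : ∀ A : X'.affineOpens, ((⨆ i, I i).comap b).ideal A = ⨆ i, ((I i).comap b).ideal A :=
    fun A => by
    rw [(Scheme.IdealSheafData.map_gc b).l_iSup, Scheme.IdealSheafData.ideal_iSup, iSup_apply]
  have hJmul : ∀ (A : X'.affineOpens) i j, i ≠ j →
      ((I i).comap b).ideal A * ((I j).comap b).ideal A = ⊥ := fun A i j hij => by
    rw [← Pi.mul_apply, ← Scheme.IdealSheafData.ideal_mul, ← comap_mul, hImul i j hij,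
      Scheme.IdealSheafData.comap_bot, Scheme.IdealSheafData.ideal_bot, Pi.bot_apply]
  refine ⟨⨆ i, I i, X', b, T, fun W => ?_, ?_, hb, ?_, fun i j hij => ?_, fun i => ?_⟩
  · -- finite type
    rw [Scheme.IdealSheafData.ideal_iSup, iSup_apply]
    exact Submodule.fg_iSup _ fun i => hIfg i W
  · -- admissible: `Supp (∑ 𝓘ᵢ) = ⋂ (X ∖ Uᵢ)`
    rw [Set.disjoint_left]
    intro x hx hxC
    obtain ⟨i, hxi⟩ := Opens.mem_iSup.mp hx
    rw [SetLike.mem_coe, Scheme.IdealSheafData.support_iSup, Closeds.mem_iInf] at hxC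
    have hxi' : x ∈ ((I i).support : Set X) := hxC i
    rw [hIsupp i] at hxi'
    exact hxi' hxi
  · -- cover: at each point exactly one `𝓘ᵢ𝒪_{X'}` is the exceptional ideal, the others die nearby
    rw [eq_top_iff]
    rintro p -
    obtain ⟨A, hpA, -, t, ht, htA⟩ := hb.isEffectiveCartier.exists_chart_le p ⊤ trivial
    rw [hE] at htA
    obtain ⟨i, g, hgp, hg⟩ := Ideal.exists_away_forall_ne_map_eq_bot
      (fun i => ((I i).comap b).ideal A) (fun i => fg_ideal_comap b (hIfg i) A) ht htA (hJmul A)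
      (A.2.primeIdealOf ⟨p, hpA⟩).asIdeal
    have hpg : p ∈ X'.basicOpen g := by
      rw [← A.2.fromSpec_image_basicOpen g]
      exact ⟨A.2.primeIdealOf ⟨p, hpA⟩, hgp, A.2.fromSpec_primeIdealOf ⟨p, hpA⟩⟩
    haveI := A.2.isLocalization_basicOpen g
    have hkill : ∀ j : {j // j ≠ i}, ((I j).comap b).ideal (X'.affineBasicOpen g) = ⊥ := fun j => by
      rw [← ((I j).comap b).map_ideal_basicOpen A g]
      exact hg Γ(X', X'.basicOpen g) j j.2
    have hle : (X'.basicOpen g : X'.Opens) ≤ T i :=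
      le_iInf fun j : {j // j ≠ i} => le_vanishingOpen ((I j).comap b) (hkill j)
    exact Opens.mem_iSup.mpr ⟨i, hle hpg⟩
  · -- disjoint: on `Tᵢ ∩ Tⱼ` every `𝓘ₖ𝒪_{X'}` dies, so the exceptional generator vanishes
    rw [eq_bot_iff]
    rintro p ⟨hpi, hpj⟩
    obtain ⟨A, hpA, hA, t, ht, htA⟩ := hb.isEffectiveCartier.exists_chart_le p (T i ⊓ T j) ⟨hpi, hpj⟩
    have hzero : ∀ k, ((I k).comap b).ideal A = ⊥ := fun k => by
      refine ideal_eq_bot_of_le_vanishingOpen _ A ?_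
      by_cases hki : k = i
      · subst hki
        exact hA.trans (inf_le_right.trans (iInf_le (fun l : {l // l ≠ j} =>
          vanishingOpen ((I l).comap b)) ⟨k, hij⟩))
      · exact hA.trans (inf_le_left.trans (iInf_le (fun l : {l // l ≠ i} =>
          vanishingOpen ((I l).comap b)) ⟨k, hki⟩))
    rw [hE] at htA
    simp only [hzero, iSup_bot] at htA
    rw [eq_comm, Ideal.span_singleton_eq_bot] at htA
    have h10 : (1 : Γ(X', A)) = 0 :=
      (mul_right_mem_nonZeroDivisors_eq_zero_iff ht).mp (by rw [htA, mul_zero])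
    have : p ∈ X'.basicOpen (1 : Γ(X', A)) := by
      rw [Scheme.basicOpen_one]
      exact hpA
    rw [h10, Scheme.basicOpen_zero] at this
    exact this
  · -- `b⁻¹ Uᵢ ⊆ Tᵢ`
    refine le_iInf fun j => ?_
    rw [← hIU i]
    exact preimage_centreCompl_le_vanishingOpen (I i) (I j) b (hImul i j (Ne.symm j.2))

end Statement


end Literature.AlgebraicGeometry.Resolution

end
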